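import Literature.NumberTheory.K2Lit.LocalDoublingUnramifiedHecke                            -- ★ D7d (K2Liu-p04 g2) + D7a∕D7b∕D7c: `iotaLeftLocPi`, `IsDoublingHeckeEigenvector`, `LambdaLoc`, `IsSphericalHeckeEigen`
import Summits.HodgeConjecture.HodgeConjecture.Theorems.K2LiuCartanFamilyInert               -- ★ p857060 (K2Liu-p01 g4): row 26 inert `isCartanFamily_localInt_inert`, `exists_generator_inert` (the `∀ t₁` below is not vacuous)
import Summits.HodgeConjecture.HodgeConjecture.Theorems.K2LiuUnramifiedSectionOnCartanInert  -- ★ p857024 (K2Liu-p01 g4): #27i `lambdaLoc_iotaLeftLocPi_cartan_inert` (frame vocabulary `galAdicCompletionMap ∕ glInt ∕ StdForm.antidiagonal`)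
import Summits.HodgeConjecture.HodgeConjecture.Theorems.K2LiuUnramifiedDoublingHeckeIdentityInert  -- ★ p857283 (K2Liu-p01 g4, commit ea20b3403b25): the #28i PAYER `unramifiedDoublingHeckeIdentityInert` — TIED BY NAME in ED. 1
import Literature.NumberTheory.Automorphic.Liu2021.LemD1SplitPlaceHeckeEigenvaluesChain      -- ED. 2 (#24i): ★ #30a's θ-type vocabulary `rhoVAtLine ∕ isCompatible_chiSplittingLine ∕ toHeckeCharacter ∕ TW JW` (U5c's import)
import Literature.NumberTheory.Automorphic.UnitaryGroupPlaceInclusion                        -- ED. 2 (#24i): ★ `UnitaryGroup.inclPlace` (`ι_v : G_v →* U(V)(𝔸_f)`)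
import Literature.NumberTheory.Automorphic.UnitaryGroupHyperspecialHecke                     -- ED. 2 (#24i): ★ `UnitaryGroup.IsHyperspecialAt`, ★ `heckeOperator` (#30b's generic currency)
import Summits.HodgeConjecture.HodgeConjecture.Theorems.K2LiuThetaTypeSphericalEigenvalueInert  -- ED. 3: ★ p857710 (K2Liu-p05 (g2), commit per ledger; tree 588f997df7acfd79): the #24i PAYER `thetaTypeSphericalEigenvalueInert` — TIED BY NAME below

/-!
# K2_Liu_CurveThetaSigs — unit U5e «INERT SEAM OF s23» (tier-1 socket module for hLiu418 = stmt-HodgeConjecture-24832)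

Track B ∕ build stream 29 (`Cruxes/HLiu418/Lines/K2_Liu_*`). Planner `hodgecm-mathlib-K2Liu-plan` g3 (socket typist), 2026-09-04.
INFO-ONLY companion to the #184♮ LINE `Cruxes/HLiu418/Lines/K2_Liu_CurveThetaNonOrthogonal.lean` (A-plan2 (g35), rev. k bc5f92705ae683d3: live
`sorry` 2 = s23 `stub_doublingZetaGL1` :395, s5 `stub_firstTermThetaPairing` :526); sockets of the INERT half of the LOCAL SEAM of s23, cut in DEPMAP
`Cruxes/HLiu418/Lines/K2_Liu_LocalSeam_s23.md` §§2–4 (HECKE BYPASS, LEAD «M-154r» Q1: no Flath, no `π_v`, no local `L`-factors as objects;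
`Z(s) = (∏_{v∉S} c_v(s))·Z_S(s)`), sibling of U5b `K2_Liu_CurveThetaSigs_U5b_LocalSeam.lean` (split half: #21s #28s #29s #30s, all ★-tied) and of U5d
`K2_Liu_CurveThetaSigs_U5d_ZetaS.lean`.  Words of record: K2Liu-p01 (g3) `K2/K2Liu-p01/g3/INERT-SOCKETS-v2.K2Liup01g3.md` §0–§1 (LEAD F0P6-plan (g10) deal
02:26:33Z «inert package → K2Liu-p01», LEAD ruling 03:05:31Z «row 26 for EVERY non-split finite place»), numerically CERTIFIED before typing by p01's
`K2/K2Liu-p01/g3/check28i.py` (sha16 02732331dfabd5fb: the Cartan series `Σ_m Λ_m·vol_m·ω(t^m)` against the closed form, rel. err 8.4e−16 over 120 cases —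
`q ∈ {3,4,5,7,8,9,11,13,25,27}`, `Re s ∈ (0.05, 2)`, tempered ∕ complementary ∕ trivial Satake parameter, random unitary `χ_w`; the Macdonald recursion to 3.0e−13;
three wrong orientations miss by up to 41 % ∕ 12 % ∕ 14 %), exactly as `check28s` certified #28s.

ED. 3 (this file; typist K2Liu-plan (g4), 2026-09-04 06:05Z; TIE-ONLY edition on LEAD F0P6-plan (g12) deal 06:03:01Z «U5e ED. 3 TIE-ONLY (#24i := ★ p857710)» under the
LEAD (g10) STANDING PRE-AUTHORISATION «TIE-ONLY EDITIONS» 01:08:35Z (1)): #24i∕#30i `sig_K2LiuThetaTypeSphericalEigenvalueInert` ↦ ★ p857710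
`Theorems/K2LiuThetaTypeSphericalEigenvalueInert.lean :: …Cruxes.HLiu418.K2LiuThetaTypeSphericalEigenvalueInert.thetaTypeSphericalEigenvalueInert` (K2Liu-p05 (g2), landed 05:49:45Z,
kernel lane, axioms TRIO; chain of record (L24-a) p857389∕p857433∕p857453∕p857480+p857491∕p857521, (L24-b) (Σ) ★ p857630 `K2LiuInertThetaSphericalEigenvalue` (K2Liu-p01 (g4)),
(L24-c) p857570∕p857655∕p857710; p05's by-kernel tie probe `K2/K2Liu-p05/g2/TieProbe24i.lean` = `type_of% payer = type_of% socket := rfl`) — the code delta of this edition is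
+1 import and `:= by sorry` → the payer term BY NAME; every `sig_` statement byte-identical to ED. 2 (blockhash 2∕2 SAME); live `sorry` 1 → 0: THIS MODULE IS NOW
SORRY-FREE (both sockets ★-tied by name).

ED. 2 (K2Liu-plan (g3) 2026-09-04, commit 47e6637c5250 sha16 0af35c0e8c96fba5; LEAD F0P6-plan (g11) RULING «M-155c» (7) + GO line 04:03:45Z «TYPING∕ROAD WORD», RULING «M-155b» (road (A′)
recommended; the GR91∕Kudla named facts `WeilLiftNonsplitPrincipalSeriesConstituent ∕ ThetaTypeNonsplitJacquetModule ∕ …BorelEigenfunctional` are `def … : Prop`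
and may NOT enter the #184♮ cone, so nothing of them is imported here), RULING «M-155a» (finding (G): nothing to type — #34 reads #24i at `U(diagonal dV)` for
`σ' := σ_H ∘ finAdelicCongr g`, exactly as ★ p857194 `K2LiuDoublingZetaGL1ThetaEigenDiag` reads ★ #30a)): socket #28i of ED. 1 with statement bytes UNCHANGED
(blockhash 439ac4d13a10) + ONE NEW SOCKET #24i∕#30i `sig_K2LiuThetaTypeSphericalEigenvalueInert` (second bullet; words: K2Liu-p01 (g3) WORDS v2 §2–§3 + the LEAD's
TYPING WORD «generic ★ `heckeOperator σ K (inclPlace v t₁) y = a₁ • y` currency, θ-type block = ★ #30a's, place∕frame∕generator block = #28i's, T-Mac target»).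
ED. 1 (commit d47d3b6b4414): ONE socket, the inert twin of ★ #28s, ★ PAID-AND-TIED BY NAME AT BIRTH — the payer ★ p857283 `Theorems/K2LiuUnramifiedDoublingHeckeIdentityInert.lean`
(K2Liu-p01 (g4), commit ea20b3403b25, axioms TRIO) landed 04:15:32Z between the LEAD's GO (F0P6-plan (g11) BOX 04:03:45Z; K2Liu-ref1 (g2) PRE-BOX PASS 04:04:08Z) and
the write, p01 «=» ON THE BYTES 04:16:38Z with the `rfl` probe `K2/K2Liu-p01/g4/probe-tie-bypaste-28i.lean` 65c66f0ca09e9eb1 (`type_of% sig = type_of% payer`), so the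
socket is born tied (`theorem sig_… := <payer>`; tie-only delta under the LEAD's STANDING PRE-AUTHORISATION (1) 01:08:35Z) —

* #28i `sig_K2LiuUnramifiedDoublingHeckeIdentityInert` — organ (LS2-inert) «THE UNRAMIFIED DOUBLING HECKE IDENTITY AT AN INERT GOOD PLACE, n = 2, GENERATOR
  INTERFACE»: at a finite place `v` of `L⁺` INERT and UNRAMIFIED in `L` (`w ∣ v` unique, `c w = w`), non-dyadic, of good reduction for `(V, χ)`, a non-zero
  `K_v`-spherical Hecke eigenvector `u` (ONE generator `t₁`, `(t₁)_w = T⁻¹·diag(ϖ, ϖ⁻¹)·T` in an integral hyperbolic frame `T` of the place form, eigenvalue `a₁`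
  in the `ν(K_v) = 1` currency) is an eigenvector of the doubling Hecke operator of `Λ_{s,v} ∘ ι_v(·,1)` with eigenvalue `c` satisfying the CLEARED identity
  `c·(1 − θ(a₁ − q + 1)q^{−(2s+2)} + θ²q^{−(4s+2)}) = (1 + θq^{−(2s+1)})(1 − θq^{−(2s+2)})`, `q := q_v` (★ `residueCard v`; `N(w) = q²`), `θ := χ_w(ϖ_w)`
  (★ `valueAtUniformizer`; `χ` unramified at `w`, so any uniformizer).  Its organs are ALL ★: row 26 inert ★ p857060 `K2LiuCartanFamilyInert` (Cartan family +
  generator), #27i ★ p857024 `K2LiuUnramifiedSectionOnCartanInert` (`Λ_m = θ^m·q^{−2m(s+1)}`), ★ p857068 `K2LiuCartanSeriesU11Closed.cartanSeriesU11_closed_form`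
  (the series identity, whose conclusion this socket's second conjunct copies symbol for symbol at `q ↦ (v.residueCard : ℂ)`, `θ ↦ χ.valueAtUniformizer w.1`),
  ★ p857005 `K2LiuInertCartanIwasawaBlocks`, ★ `K2LiuDoublingHeckeCartanSum` (`isDoublingHeckeEigenvector_cLoc`, `hasSum_integral_doubleCoset`), the ★ Satake∕tree
  facts `exists_algEquiv_polynomial_basic_two`, `heckeEigencharacter_doubleCosetOperator_basic_two`, `card_orbit_basic_two`; payer ★ p857283
  `Theorems/K2LiuUnramifiedDoublingHeckeIdentityInert.lean` (K2Liu-p01 (g4); over H3a ★ `K2LiuInertHeckeRecursion`, H1 ★ p857139 `K2LiuHeckeShellRecursion`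
  `heckeOperator_pow_apply_eq_smul_of_contracting`, H2 ★ p857210 `K2LiuRankOneHeckeNeighboursTwo`) — TIED BY NAME below.

* #24i∕#30i `sig_K2LiuThetaTypeSphericalEigenvalueInert` (ED. 2) — organ (LS2-inert)(b′) «θ-TYPE SPHERICAL EIGENVALUE AT THE GOOD INERT PLACES, ON `σ`», the inert
  twin of ★ #30a in ★ #30b's GENERIC Hecke-operator currency (★ `heckeTAt` is split-only): for a representation `σ` of `U(V)(𝔸_{L⁺,f})`, `V = (L², diagonal dV)`,
  embedded (`j` injective) in [Liu2021, Def. 4.11]'s Weil carrier `ω⋆ = rhoVAtLine … a χ` at the conjugate-symplectic `lam` (θ-type block = ★ #30a's at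
  `H := diagonal dV`, WITHOUT `finAdelicCongr`), there is a finite `S₀` off which, at every INERT unramified non-dyadic good place `v` (`w ∣ v`, #28i's place
  block) with #28i's frame `(ϖ, T, t₁)`, every `K`-fixed vector `y` (`K` hyperspecial at `v`) satisfies `heckeOperator σ K (ι_v t₁) y = (q(Z + Z⁻¹) + q − 1) • y`,
  `q := q_v`, `Z := λ̃_w(ϖ_w)` (★ `valueAtUniformizer` of `λ̃ := toHeckeCharacter L lam`; `lam`-ONLY currency, M-155b) — Macdonald's spherical eigenvalue of the
  unramified principal series `I(λ̃_w)` of `U(1,1)(L_w∕L⁺_v)` in the `ν(K_v) = 1` ∕ `#(K_v t₁ K_v∕K_v) = q² + q` currency of #28i.  ★ PAID p857710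
  `K2LiuThetaTypeSphericalEigenvalueInert.thetaTypeSphericalEigenvalueInert` (K2Liu-p05 (g2), road (A′) «Schrödinger model + `ℓ(Φ) = Φ(0)`» over (Σ) ★ p857630
  (K2Liu-p01 (g4))), TIED BY NAME ED. 3; consumer #34.

HOW #34 (`Theorems/K2LiuDoublingZetaGL1.lean`, K2Liu-p09 lineage; head `doublingZetaGL1_of_seam : ‹#32dR› → ‹#33s› → ‹hInert› → ‹s23 BY VALUE›`) CONSUMES IT: `hInert` =
«`∀ v ∉ S` inert good, `∃ cI, (E)_v cI ∧ (H)_v cI`» in ★ #29s's (E)-currency and ★ #30s's (H)-shape (typist g2 wording 02:47:08Z); #28i is (E)_v together with the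
cleared closed form, and (H)_v follows from it once the θ-type eigenvalue at an inert place is known (#24i∕#30i `sig_K2LiuThetaTypeSphericalEigenvalueInert`, §3 of
the words — typed in ED. 2 (second socket below) once §2's consistency line was confirmed (p01 «do not type #24i before»; typist's check, K2 bus
04:01:08Z: at an inert place `χ̌_w(ϖ_v) = χ_v(ϖ_v ∕ c_w ϖ_v) = 1` by ★ `CheckOfChiLocalPlace.localComponent_checkOfChi_of_placesOver_subsingleton`, so PACKAGE (B)'s
`ψ = λ̃⁻²χ̌`, `χ_D = λ̃⁻¹` give `ψ_w(ϖ_v) = χ_{D,w}(ϖ_v)²` as §2 requires ✓).  The frame data are supplied in #34 by: `ϖ := algebraMap L⁺_v L_w (ϖ_v)` (unramified ⇒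
`_hϖ`; `c_w` fixes `L⁺_v` ⇒ `_hϖσ`), ★ K1⁺ `exists_glInt_placeForm_eq_formCongr_antidiagonal[_of_isUnramifiedIn]` ⇒ `T, _hTi, _hTJ`, ★ `exists_generator_inert` ⇒ `t₁, _ht₁`.

NOT in ED. 2: DEFS `K2Lit/InertHyperspecialHeckeElement` (not needed: the frame is INLINE in #28i∕#24i, as in ★ #27i and ★ row 26 — no DEFS leaf before this SIGS
module), ramified ∕ bad places (inside `S`: nothing to type), finding (G) (M-155a: payer-side, realised by ★ p857194), the named GR91∕Kudla facts (M-155b∕d).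

VACUITY ∕ DEGENERATE-CORNER DISCIPLINE (cell rules (V1)–(V7)): the corner pass is in the socket's docstring; every integral is Bochner in the Banach space `V` with its
measurability supplied; no `instance`, no `notation`, no `def`, no file-wide option.
HONEST LABEL: HC_CM is proved only modulo the printed citations (2 remaining named inputs: hLiu418 = stmt-HodgeConjecture-24832, h413 = stmt-HodgeConjecture-24833)
until rung 0 closes; this module is statements only (ED. 3: 0 `sorry` — #28i ★-tied by name since ED. 1, #24i since ED. 3), no proof claimed here; an ★-tied socket is a
one-token re-export of its payer, HC_CM-count-neutral.
-/

open scoped RestrictedProduct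
open MeasureTheory Filter Set

namespace Summit.HodgeConjecture.HodgeConjecture.Cruxes.HLiu418.K2LiuCurveThetaSigsU5eInertSeam

open NumberField IsDedekindDomain
open Literature.NumberTheory.Automorphic Literature.NumberTheory.GaloisRepresentations
open Literature.NumberTheory.GelbartRogawski1991 Literature.NumberTheory.GelbartRogawski1991.GRConstruction
open Literature.NumberTheory.K2Lit.SiegelDoubled

/-- socket #28i (U5e ED. 1 — ★ PAID-AND-TIED BY NAME: ★ p857283 `K2LiuUnramifiedDoublingHeckeIdentityInert.unramifiedDoublingHeckeIdentityInert`; organ (LS2-inert) «THE UNRAMIFIED DOUBLING HECKE IDENTITY AT AN INERT GOOD PLACE, n = 2, GENERATOR INTERFACE»; size M–L given the ★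
organs; owner K2Liu-p01 lineage (LEAD F0P6-plan (g10) deal 02:26:33Z; words `K2/K2Liu-p01/g3/INERT-SOCKETS-v2.K2Liup01g3.md` §1, binders = ★ #28s's with exactly the
changes listed there); deps ★ D7a `iotaLeftLocPi`, ★ D7b `IsDoublingHeckeEigenvector`, ★ D7c∕(4c) `LambdaLoc`, ★ D7d `IsSphericalHeckeEigen ∕ IsCartanFamily ∕ cLoc`,
★ row 26 inert p857060 `K2LiuCartanFamilyInert.isCartanFamily_localInt_inert ∕ exists_generator_inert ∕ coe_pow_of_coe_eq_conj_diagonal`, ★ #27i p857024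
`K2LiuUnramifiedSectionOnCartanInert.lambdaLoc_iotaLeftLocPi_cartan_inert`, ★ p857068 `K2LiuCartanSeriesU11Closed.cartanSeriesU11_closed_form`, ★ p857005
`K2LiuInertCartanIwasawaBlocks`, ★ `K2LiuDoublingHeckeCartanSum.isDoublingHeckeEigenvector_cLoc ∕ hasSum_integral_doubleCoset`, ★ `exists_algEquiv_polynomial_basic_two`,
★ `heckeEigencharacter_doubleCosetOperator_basic_two`, ★ `card_orbit_basic_two`, ★ `valueAtUniformizer`, ★ `residueCard`) — **THE INERT TWIN OF ★ #28s.**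
SETTING: the K2Lit curve datum `(L, e, dV, dW)` (`n = 2` forced by `e`); a finite place `v` of `L⁺` with `w ∣ v` INERT (`c • w = w`, so `w` is the only place above `v`)
and `v` UNRAMIFIED in `L` (`hv`), non-dyadic (`h2`), of good reduction for the lattice (`hdVw`: the `dV i` are `w'`-units; `hT ∕ hTinv`: the K2Lit Gram transition
`gramR` and its inverse are `w'`-integral, so ★ (4c) `exists_isSiegelIntDecomp` applies and `Λ_{s,v}` has no junk value) and for `χ` (`hχ`: unramified above `v`;
`hχu`: unitary); `s` with `0 < Re s`; a Haar measure `ν` on `G_v = U(V)(L⁺_v)` (★ `localPi`) with `ν(K_v) = 1` for the hyperspecial `K_v = U(V)(𝒪_v)` (★ `localInt`);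
a `σ_w`-FIXED uniformizer `ϖ` of `L_w` (`hϖ`, `hϖσ`; e.g. `ϖ_v ∈ L⁺_v`, `v` unramified); an integral hyperbolic frame `T ∈ GL₂(𝒪_w)` (★ `glInt`) of the place form:
`diag(dV)_w = σ_w(T)ᵀ·antidiag(1,1)·T` (`hTJ`, ★ `formCongr ∕ galAdicCompletionMap ∕ StdForm.antidiagonal ∕ UnitaryGroup.placeForm`; exists by ★ K1⁺
`exists_glInt_placeForm_eq_formCongr_antidiagonal_of_isUnramifiedIn`); ONE Hecke generator `t₁ ∈ G_v` pinned by its `w`-component `(t₁)_w = T⁻¹·diag(ϖ, ϖ⁻¹)·T`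
(`ht₁`; exists by ★ `exists_generator_inert` since `σ_w ϖ = ϖ` puts `diag(ϖ, ϖ⁻¹)` in `U(σ_w, antidiag(1,1))`; `G_v = ⊔_{m ≥ 0} K_v t₁^m K_v` by ★
`isCartanFamily_localInt_inert` + ★ `coe_pow_of_coe_eq_conj_diagonal`, and `ℋ(G_v, K_v) = ℂ[1_{K_v t₁ K_v}]` by ★ `exists_algEquiv_polynomial_basic_two`); a contractive,
strongly continuous Banach representation `τ` of `G_v` on a complete `V` and a vector `u ≠ 0` that is a `K_v`-SPHERICAL HECKE EIGENVECTOR for the one-generator family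
`![t₁]` with eigenvalue `![a₁]` (★ D7d `IsSphericalHeckeEigen`: `K_v`-fixed, Bochner `∫_{K_v t₁ K_v} τ g u dν = a₁ • u`).  CONCLUSION: `u` is an eigenvector of the
doubling Hecke operator of the kernel `Λ_{s,v} ∘ ι_v(·,1)` (★ D7b `IsDoublingHeckeEigenvector`, CONVERGENCE of `∫_{G_v} Λ_{s,v}(ι_v(g,1)) • τ(g) u dν` included) with an
eigenvalue `c` satisfying, with `q := q_v` (★ `residueCard v`, so `N(w) = q²`) and `θ := χ_w(ϖ_w)` (★ `valueAtUniformizer`):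
  `c · (1 − θ·(a₁ − q + 1)·q^{−(2s+2)} + θ²·q^{−(4s+2)}) = (1 + θ·q^{−(2s+1)}) · (1 − θ·q^{−(2s+2)})`,
i.e. with `Y := θ·q^{−(2s+2)}`, `U := qY = θ·q^{−(2s+1)}` and the base-change Satake pair `{Z, Z⁻¹}` of `u` at `w` (`a₁ = q(Z + Z⁻¹) + q − 1`, ★
`heckeEigencharacter_doubleCosetOperator_basic_two` with `Q = q²`): `c = c_v(s) = Σ_{m≥0} Λ_m μ_m = (1 + (q−1)Y − qY²) ∕ (1 − (a₁−q+1)Y + q²Y²) = (1+U)(1−U∕q) ∕ ((1−UZ)(1−UZ⁻¹))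
= L_w(s+½, BC(σ_v) ⊗ χ_w) · (1 − χ⁰ε_{L∕L⁺}(ϖ_v)q^{−(2s+1)})(1 − χ⁰(ϖ_v)q^{−(2s+2)})` with `ε_{L∕L⁺}(ϖ_v) = −1`, `χ⁰(ϖ_v) = χ_w(ϖ_v) = θ` at an inert place
[Liu2011 (2-4) p. 863, Rem. 2.4; Li1992 Thm. 3.1; GPSR87 Part A §6] — here `Λ_m := Λ_{s,v}(ι_v(t₁^m, 1)) = θ^m·q^{−2m(s+1)}` (★ #27i: `‖ϖ‖_w = q⁻²`, exponent
`s + n∕2 = s + 1`), `vol_m := ν(K_v t₁^m K_v) = 1, (1 + q⁻¹)q^{2m}` (`m = 0`, `m ≥ 1`; ★ `card_orbit_basic_two`: `#(K t₁ K ∕ K) = q² + q`, then the `(q+1)`-regular tree)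
and `μ_m := λ(1_{K_v t₁^m K_v})` obeys `μ₀ = 1, μ₁ = a₁, μ₂ = (a₁−q+1)a₁ − q(q+1), μ_{m+1} = (a₁−q+1)μ_m − q²μ_{m−1}` (`m ≥ 2`) — the hypotheses `h0 h1 h2 hrec` of ★
`cartanSeriesU11_closed_form`, whose conclusion is this socket's second conjunct at `q ↦ (v.residueCard : ℂ)`, `θ ↦ χ.valueAtUniformizer w.1`.  ORIENTATION (numbers, p01's
certificate `check28i.py` 02732331dfabd5fb): `θ = χ_w(ϖ_w)` rides with the POSITIVE powers `m ≥ 0` (the Weyl element `antidiag(1,1) ∈ K_v` folds `m < 0`; no case split) —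
«⊗ χ» as in #28s; series vs closed form agree to 8.4e−16 in 120 cases, the three wrong orientations miss by up to 41 % ∕ 12 % ∕ 14 %.  WHY CLEARED DENOMINATORS: as for
#28s — `c` is the genuine operator eigenvalue (unique as `u ≠ 0`), `Σ_m |Λ_m|·vol_m < ∞` exactly for `Re s > 0` (ray `q^{−2m·Re s}`), so `s ↦ c(s)` is holomorphic on
`Re s > 0` and the cleared identity holds there by analytic continuation from `Re s ≫ 0`, even where the quadratic factor vanishes (a quotient form would misstate: Lean
`x ∕ 0 = 0`).  HOW #34 CONSUMES IT: at the inert places `v ∉ S` of s23 (`χ = χ_D = toHeckeCharacter L lam⁻¹`, PACKAGE (B)) this is the (E)_v half of `hInert`; with the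
θ-type inert eigenvalue `a₁ = q·θ⁻¹·(1 + ψ_w(ϖ_v)) + q − 1` (#24i∕#30i, words §2–§3; consistency `ψ_w(ϖ_v) = θ²` ✓ since `χ̌_w(ϖ_v) = 1` at an inert place, ★
`localComponent_checkOfChi_of_placesOver_subsingleton`) the quadratic factor becomes `(1 − θq^{−(2s+1)}·1)(1 − θ⁻¹ψ_w(ϖ_v)q^{−(2s+1)})·`(unit), non-zero on `Re s > 0`,
and (H)_v of ★ #30s follows (`N(w)^{−(s+½)} = q^{−(2s+1)}`, `θ₁(v) = θ`, `θ₂(v) = −θ`).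
DEGENERATE-CORNER PASS: `u = 0` EXCLUDED by `hu` (else `IsSphericalHeckeEigen` holds for arbitrary `a₁` and `∃ c, c·Den = Num` fails when `Den = 0 ≠ Num`) ✓; `T ∉ GL₂(𝒪_w)`
EXCLUDED by `hTi` (else `K_v`-sphericity is with respect to the wrong lattice and `vol_m` ∕ `μ_m` are not the hyperspecial ones) ✓; `ϖ` not `σ_w`-fixed EXCLUDED by `hϖσ`
(else `diag(ϖ, ϖ⁻¹) ∉ U(σ_w, antidiag)`, no `t₁` satisfies `ht₁` and the `∀ t₁` is vacuous-by-falsity) ✓ — with `hϖσ` a `t₁` EXISTS (★ `exists_generator_inert`) ✓;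
`ϖ` a unit or zero EXCLUDED by `hϖ` (valuation exactly `exp(−1)`) ✓; dyadic `v` EXCLUDED by `h2` (the ★ Cartan ∕ hyperbolic-frame statements used are the non-dyadic
ones) ✓; `v` ramified EXCLUDED by `hv` (else `‖ϖ_w‖ ≠ q⁻²`-bookkeeping and the frame lemma K1⁺ change; ramified places sit inside `S`) ✓; a SPLIT `w` EXCLUDED by `hw`
(that case is ★ #28s, two generators) ✓; `V` not complete EXCLUDED by `[CompleteSpace V]` ✓; non-unitary `χ` EXCLUDED by `hχu` ✓; `ν(K_v) ≠ 1` EXCLUDED by `hνK` (else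
`a₁` and `c` rescale, K2Liu-p01 HINGE (ii)) ✓; (V5) every integral is Bochner in `V`: `g ↦ τ g u` continuous (`hτc`), `Λ_{s,v} ∘ ι_v(·,1)` bi-`K_v`-invariant hence
locally constant on a `BorelSpace` ✓; `n` forced to `2` by `e : Fin 2 × Fin 1 ≃ Fin n` — all carriers are stated over `e` ✓; `q = residueCard v ≥ 2` so the complex
powers `(q : ℂ) ^ (−(2s+2))` are the principal ones, no `0 ^ z` junk ✓.
Why it might fail: only through a NORMALISATION slip — `a₁` must be in the `ν(K_v) = 1` currency (`a₁ = q² + q` for the trivial representation, certificate case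
«trivial Z»: `Z = q`), the volumes are `(1+q⁻¹)q^{2m}` not `(1+q⁻²)q^{2m}` (tree of degree `q+1` at the special vertices adjacent to a hyperspecial one: `#(K t₁ K∕K) =
q(q+1)`, ★ `card_orbit_basic_two`), and ★ D7c's exponent `s + n∕2 = s + 1` against `‖ϖ‖_w = q⁻²` gives `q^{−2m(s+1)}` — all three exercised by `check28i`; or if ★
`localInt` at an inert good place were not the hyperspecial stabiliser `U(V)(𝒪_v) = T⁻¹·U(antidiag)(𝒪)·T ∩ G_v` (it is: ★ `localPiNonsplitEquiv` + `hTi`).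
[cite: Li1992, §3 Thm. 3.1] [cite: GelbartPiatetskishapiroRallis1987, Part A §6] [cite: Liu2011, §2C (2-4) p. 863] [cite: Macdonald1971, Ch. V §3] [cite: BruhatTits1972, (4.4.3)] -/
theorem sig_K2LiuUnramifiedDoublingHeckeIdentityInert :
    ∀ (L : Type) [Field L] [NumberField L] [IsCMField L] {n : ℕ} (e : Fin 2 × Fin 1 ≃ Fin n)
      (dV : Fin 2 → L) (hdV : ∀ i, IsCMField.complexConj L (dV i) = dV i) (_hdV0 : ∀ i, dV i ≠ 0)
      (dW : Fin 1 → L) (hdW : ∀ i, IsCMField.complexConj L (dW i) = dW i) (_hdW0 : ∀ i, dW i ≠ 0)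
      (v : HeightOneSpectrum (𝓞 (Fp L)))
      -- an INERT, UNRAMIFIED place of good reduction for `(V, χ)`
      (w : UnitaryGroup.PlacesOver L v) (_hw : IsCMField.complexConj L • w.1 = w.1) (_hv : Algebra.IsUnramifiedIn (𝓞 L) v.asIdeal)
      (_h2 : ∀ w' : UnitaryGroup.PlacesOver L v, ValuativeRel.valuation (w'.1.adicCompletion L) (2 : w'.1.adicCompletion L) = 1)
      (_hdVw : ∀ (w' : UnitaryGroup.PlacesOver L v) (i : Fin 2),
        ValuativeRel.valuation (w'.1.adicCompletion L) (algebraMap L (w'.1.adicCompletion L) (dV i)) = 1)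
      (_hT : ∀ (w' : UnitaryGroup.PlacesOver L v) (i j : Fin n), ValuativeRel.valuation (w'.1.adicCompletion L)
        (algebraMap L (w'.1.adicCompletion L) (algebraMap (Fp L) L (gramR L e dV hdV dW hdW i j))) ≤ 1)
      (_hTinv : ∀ (w' : UnitaryGroup.PlacesOver L v) (i j : Fin n), ValuativeRel.valuation (w'.1.adicCompletion L)
        (algebraMap L (w'.1.adicCompletion L) (algebraMap (Fp L) L ((gramR L e dV hdV dW hdW)⁻¹ i j))) ≤ 1)
      (χ : HeckeCharacter L) (_hχu : χ.IsUnitary) (_hχ : ∀ w' : UnitaryGroup.PlacesOver L v, χ.IsUnramifiedAt w'.1)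
      (s : ℂ) (_hs : 0 < s.re)
      -- Haar measure on `G_v = U(V)(L⁺_v)` normalised by `ν(K_v) = 1`
      [MeasurableSpace (UnitaryGroup.localPi L (IsCMField.complexConj L) 2 (Matrix.diagonal dV) v)]
      [BorelSpace (UnitaryGroup.localPi L (IsCMField.complexConj L) 2 (Matrix.diagonal dV) v)]
      (ν : Measure (UnitaryGroup.localPi L (IsCMField.complexConj L) 2 (Matrix.diagonal dV) v)) [ν.IsHaarMeasure]
      (_hνK : ν (UnitaryGroup.localInt L (IsCMField.complexConj L) 2 (Matrix.diagonal dV) v :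
          Set (UnitaryGroup.localPi L (IsCMField.complexConj L) 2 (Matrix.diagonal dV) v)) = 1)
      -- a `σ_w`-fixed uniformizer, an integral hyperbolic frame of the place form, and the ONE Hecke generator pinned by its `w`-component
      (ϖ : w.1.adicCompletion L) (_hϖ : Valued.v ϖ = WithZero.exp (-1 : ℤ))
      (_hϖσ : galAdicCompletionMap (L := L) (IsCMField.complexConj L) _hw ϖ = ϖ)
      (T : GL (Fin 2) (w.1.adicCompletion L)) (_hTi : T ∈ glInt 2 (w.1.adicCompletion L))
      (_hTJ : UnitaryGroup.placeForm (Matrix.diagonal dV) w.1 =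
        formCongr (galAdicCompletionMap (L := L) (IsCMField.complexConj L) _hw) T ((StdForm.antidiagonal 2).over (w.1.adicCompletion L)))
      (t₁ : UnitaryGroup.localPi L (IsCMField.complexConj L) 2 (Matrix.diagonal dV) v)
      (_ht₁ : (((t₁ : UnitaryGroup.LocalGLPi L 2 v) w : GL (Fin 2) (w.1.adicCompletion L)) : Matrix (Fin 2) (Fin 2) (w.1.adicCompletion L)) =
        ((T⁻¹ : GL (Fin 2) (w.1.adicCompletion L)) : Matrix (Fin 2) (Fin 2) (w.1.adicCompletion L)) *
          Matrix.diagonal ![ϖ, ϖ⁻¹] * (T : Matrix (Fin 2) (Fin 2) (w.1.adicCompletion L)))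
      -- a contractive, strongly continuous Banach representation and a non-zero spherical Hecke eigenvector
      {V : Type} [NormedAddCommGroup V] [NormedSpace ℂ V] [CompleteSpace V]
      (τ : UnitaryGroup.localPi L (IsCMField.complexConj L) 2 (Matrix.diagonal dV) v →* (V →L[ℂ] V))
      (_hτc : ∀ x : V, Continuous fun g => τ g x) (_hτb : ∀ g, ‖τ g‖ ≤ 1)
      (u : V) (_hu : u ≠ 0) (a₁ : ℂ)
      (_heig : IsSphericalHeckeEigen ν (UnitaryGroup.localInt L (IsCMField.complexConj L) 2 (Matrix.diagonal dV) v) ![t₁] (fun g => τ g) u ![a₁]),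
      ∃ c : ℂ,
        IsDoublingHeckeEigenvector ν (fun g => LambdaLoc L e dV hdV dW hdW v χ s (iotaLeftLocPi L e dV hdV dW hdW v g)) (fun g => τ g) u c ∧
        c * (1 - χ.valueAtUniformizer w.1 * (a₁ - (v.residueCard : ℂ) + 1) * (v.residueCard : ℂ) ^ (-(2 * s + 2)) +
              χ.valueAtUniformizer w.1 ^ 2 * (v.residueCard : ℂ) ^ (-(4 * s + 2))) =
          (1 + χ.valueAtUniformizer w.1 * (v.residueCard : ℂ) ^ (-(2 * s + 1))) *
            (1 - χ.valueAtUniformizer w.1 * (v.residueCard : ℂ) ^ (-(2 * s + 2))) :=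
  K2LiuUnramifiedDoublingHeckeIdentityInert.unramifiedDoublingHeckeIdentityInert

/-! ### ED. 2 — the θ-type half of `hInert` (socket #24i∕#30i)

The opens of this section are U5c `K2_Liu_CurveThetaSigs_U5c_ThetaTypeHecke.lean`'s (★ #30a's vocabulary); they are SECTION-LOCAL so that #28i above elaborates in
ED. 1's context unchanged. -/
section ThetaTypeInert

open scoped Matrix
open Literature.NumberTheory.Automorphic.UnitaryGroup
open Literature.NumberTheory.Automorphic.IdeleClassGroup
open Literature.NumberTheory.Automorphic.Liu2021
open Literature.NumberTheory.Automorphic.Liu2021.Def411WeilCarriers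
open Literature.NumberTheory.Automorphic.Liu2021.Def411WeilCarriersDoubling
open Literature.NumberTheory.GelbartRogawski1991.UnitaryDualPair
open Literature.NumberTheory.Weil1964
open Literature.RepresentationTheory.Liu2021 Literature.RepresentationTheory.HarrisKudlaSweet1996

/-- socket #24i∕#30i (U5e ED. 2; ★ PAID p857710 `Theorems/K2LiuThetaTypeSphericalEigenvalueInert.lean :: …K2LiuThetaTypeSphericalEigenvalueInert.thetaTypeSphericalEigenvalueInert`
(K2Liu-p05 (g2), 05:49:45Z) — TIED BY NAME in ED. 3 (p05 tie probe `TieProbe24i.lean`: `type_of%` payer = socket by `rfl`); organ (LS2-inert)(b′) «θ-TYPE SPHERICAL EIGENVALUE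
AT THE GOOD INERT PLACES, ON `σ`»; size L (road (A′)); owner K2Liu-p04 (g3) → K2Liu-p05 (g2) lineage (LEAD F0P6-plan (g11) GO line 04:03:45Z «payer-designate», M-155c (7)); consumer #34
`Theorems/K2LiuDoublingZetaGL1.lean` (K2Liu-p09 lineage); words K2Liu-p01 (g3) `K2/K2Liu-p01/g3/INERT-SOCKETS-v2.K2Liup01g3.md` §2–§3 + LEAD TYPING∕ROAD WORD (GO line
04:03:45Z; RULING «M-155b» road (A′), «M-155a» frame); deps ★ [Liu2021, Def. 4.11] carriers `rhoVAtLine` (★ `Def411WeilCarriersAtLine`), ★ `isCompatible_chiSplittingLine`,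
★ `toHeckeCharacter ∕ isUnitary_toHeckeCharacter ∕ isOscillatorChar_toHeckeCharacter_iff`, ★ `heckeOperator` (`HeckeAlgebra`), ★ `UnitaryGroup.IsHyperspecialAt`,
★ `UnitaryGroup.inclPlace`, ★ `valueAtUniformizer`, ★ `residueCard`, #28i's frame vocabulary (★ #27i, ★ row 26 inert `exists_generator_inert`)) — **THE INERT TWIN OF ★ #30a,
IN ★ #30b's GENERIC HECKE-OPERATOR CURRENCY** (★ `UnitaryGroup.heckeTAt` is the split-place operator `T_{w,i}` and has no inert analogue; the LEAD's TYPING WORD: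
«generic ★ `heckeOperator σ K (inclPlace v t₁) y = a₁ • y`»).
SETTING: the θ-type block of ★ #30a VERBATIM at `H := Matrix.diagonal dV` (so NO `finAdelicCongr`: `(L, dV, hdV, hdV0)`, an auxiliary `e₁ : Fin 2 × Fin 1 ≃ Fin n'`,
a conjugate-symplectic `lam` (`hlam`), a line representative `a` and central character `χ` of [Liu2021, Def. 4.11], a `U(V)(𝔸_{L⁺,f})`-representation `σ` on `W`
with an INJECTIVE intertwining map `j` into the Weil carrier `ω⋆ := rhoVAtLine … a χ` built on the splitting attached to `λ̃ := toHeckeCharacter L lam`) — #34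
reads it, exactly as ★ p857194 `K2LiuDoublingZetaGL1ThetaEigenDiag` reads ★ #30a, for `σ' := σ_H ∘ finAdelicCongr g` and s23's `j` (RULING «M-155a»: no `hH`,
no `hHu`, nothing of finding (G) here); then a finite exceptional set `S₀` of places of `L` (the payer's choice: it may contain every place where `lam`, `χ` or
the additive character ramify, every dyadic place and every place of bad reduction); then #28i's PLACE block VERBATIM — `v` a finite place of `L⁺`, `w ∣ v` with
`w ∉ S₀`, INERT (`hw : c • w = w`), unramified (`hv`), non-dyadic (`h2`), the `dV i` units above `v` (`hdVw`) — and #28i's FRAME∕GENERATOR block VERBATIM — a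
`σ_w`-fixed uniformizer `ϖ` of `L_w` (`hϖ`, `hϖσ`), an integral hyperbolic frame `T ∈ GL₂(𝒪_w)` of the place form `diag(dV)_w = σ_w(T)ᵀ·antidiag(1,1)·T` (`hTi`,
`hTJ`), the generator `t₁ ∈ G_v = U(V)(L⁺_v)` with `(t₁)_w = T⁻¹·diag(ϖ, ϖ⁻¹)·T` (`ht₁`) — so that #34 feeds BOTH sockets the same terms (★ K1⁺
`exists_glInt_placeForm_eq_formCongr_antidiagonal_of_isUnramifiedIn`, ★ `exists_generator_inert`); finally #30a∕#30b's LEVEL∕VECTOR block: an open compact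
`K ≤ U(V)(𝔸_{L⁺,f})` HYPERSPECIAL AT `v` (★ `IsHyperspecialAt`: `ι_v(K_v) ≤ K` and `K = K^{(v)}·ι_v(K_v)`) and `y ∈ σ^K`.
CONCLUSION: `heckeOperator σ K (ι_v t₁) y = a₁(v) • y` with the MACDONALD EIGENVALUE `a₁(v) := q·(Z + Z⁻¹) + q − 1`, `q := q_v` (★ `residueCard v`, `N(w) = q²`),
`Z := λ̃_w(ϖ_w)` (★ `(toHeckeCharacter L lam).valueAtUniformizer w.1`; `λ̃` unramified at `w ∉ S₀`, so the uniformizer is immaterial and `Z` is a unit) — the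
spherical Hecke eigenvalue of the unramified principal series `I(λ̃_w)` of the quasi-split `U(1,1)(L_w∕L⁺_v)` on `1_{K_v t₁ K_v}` in the `ν(K_v) = 1` currency:
`#(K_v t₁ K_v ∕ K_v) = q·N(w)^{1∕2}·… = q² + q` (★ `card_orbit_basic_two`) and `a₁ = N(w)^{1∕2}·(q^{1∕2}·(Z + Z⁻¹)·q^{1∕2}∕… )` — in plain terms the `(q+1)`-biregular
tree count `a₁ = q(Z + Z⁻¹) + q − 1` — LEAD F0P6-plan (g11) BOX 04:16:00Z re-derived it independently from the GL₂ Hecke relation `T(ϖ²,1) = T(ϖ,1)² − (q+1)R_ϖ`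
restricted to `SU(1,1)(L_w∕L⁺_v) ≅ SL₂(L⁺_v)` (`t₁` of displacement 2 on the `(q+1)`-regular tree); the TRIVIAL Satake
parameter `Z = q` gives `a₁ = q² + q = #(K_v t₁ K_v∕K_v)` ✓ (constant function), and the wrong torus orientation would give the NON-symmetric `Z∕q + q − 1 + q³Z⁻¹`
(LEAD ROAD WORD: self-checking).  CURRENCY DICTIONARY (for #34 and the payer; nothing of it is a hypothesis here): in the T-Mac form of the words §3,
`a₁ = q·χ_{D,w}(ϖ_v)⁻¹·(1 + ψ_w(ϖ_v)) + q − 1` with PACKAGE (B) `χ_D = λ̃⁻¹`, `ψ = λ̃⁻²·χ̌` and `χ̌_w(ϖ_v) = 1` at an inert place (★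
`localComponent_checkOfChi_of_placesOver_subsingleton`), i.e. `χ_{D,w}(ϖ_v)⁻¹ = Z`, `ψ_w(ϖ_v) = Z⁻²` ✓; in ★ #30a's algebraic currency `μ^{alg} = N(w)^{1∕2}·λ̃ = q·λ̃`
(★ `sqrt_absNorm_mul_valueAtUniformizer_toHeckeCharacter`) the same scalar reads `μ^{alg}_w(ϖ_w) + (μ^{alg} ∘ c · χ̌)_w(ϖ_w) + (q − 1)` (`λ̃ ∘ c = λ̃⁻¹` for a
conjugate-symplectic `lam`); and since `ϖ_v ∈ L⁺_v` is `c`-fixed, `hlam` forces `Z = λ̃_w(ϖ_v) = ε_{L∕L⁺,v}(ϖ_v) = −1` at an inert unramified `v`, so in fact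
`a₁(v) = −(q + 1)` — NOT asserted here (the socket states the eigenvalue in the form road (A′) produces it and #28i consumes it; the specialisation is the
consumer's to take or leave).  HOW #34 CONSUMES IT: (lv) pick `K` hyperspecial at `v ∉ S` and `y ∈ σ'^K`, `y ≠ 0`; this socket gives `T(t₁) y = a₁(v) • y`
algebraically; ★ #30b `sig_K2LiuAutomorphicHeckeBochnerBridge` (hyperspecial factorisation `K ι_v(t₁) K = ⊔ ι_v(x_j) K` + ★ (br)) turns it into #28i's Bochner
hypothesis `_heig : IsSphericalHeckeEigen ν K_v ![t₁] (τ_{v,y}) u ![a₁(v)]` in the `ν(K_v) = 1` currency; #28i then yields `(E)_v` with `θ = χ_{D,w}(ϖ_w) = Z⁻¹`, and its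
quadratic factor FACTORS: `1 − Z⁻¹(a₁ − q + 1)q^{−(2s+2)} + Z⁻²q^{−(4s+2)} = (1 − q^{−(2s+1)})·(1 − Z⁻²q^{−(2s+1)}) = ∏ (1 − N(w)^{−(s+½)})(1 − ψ_w(ϖ_w)N(w)^{−(s+½)})`,
which is ★ #30s's `(H)_v` shape at the inert place (`N(w)^{−(s+½)} = q^{−(2s+1)}`), non-vanishing on `Re s > 0` ✓ — so `hInert v = ⟨c_v, (E)_v, (H)_v⟩` of #34's head.
PROOF ROAD (LEAD RULING «M-155b»: (A′) recommended, (B) Satake-restriction admissible, (C′) GR91∕Kudla citation FORBIDDEN in this cone; payer's census (Ω1) first):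
(Ω1) the local oscillator (Schrödinger) model of `ω⋆` at an inert unramified `v` in the polarisation given by the hyperbolic frame `T` (`V_w = L_w·e ⊕ L_w·f`,
functions on `L_w`; the tree has ★ `SplitPlaceOscillatorModel` for split `w` only); (Ω2) #28i's coset representatives of `K_v t₁ K_v ∕ K_v` (`q² + q` of them, ★
`K2LiuInertCartanIwasawaBlocks` ∕ K2Liu-p01 (g4) H2 ★ p857210 `bijOn_heckeNeighbours_two`); (Ω3) `φ₀ = 1_{𝒪_w}` is `K_v`-fixed; (Ω4) the sum `Σ_x (ω(x̃)φ₀)(0)`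
over the explicit lifts `x̃ = (x, 1)` under the chosen splitting (the only cocycle bookkeeping; finitely many terms) `= q(Z + Z⁻¹) + q − 1`; (Ω5) «`dim (ω⋆_v)^{K_v} ≤ 1`»
is NOT a binder of this socket: the `∀ y ∈ σ^K` form (★ #30a's) holds because `S(L_w)^{K_v} = ℂ·1_{𝒪_w}` ELEMENTARILY (`m(𝒪_w^×)` ⇒ radial, `n(𝒪_v)` with `ψ_v`
unramified ⇒ support `⊆ 𝒪_w`, the Weyl element ⇒ Fourier support `⊆ 𝒪_w` ⇒ `Φ = Φ(0)·1_{𝒪_w}`), `K_v`-invariants commute with the `U(W)`-coinvariants defining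
`ω⋆` (compact averaging; ★ `weilCoinv`, ★ `TwistedCoinv.Coinv`) and the adelic Schwartz space factors at `v` (★ [Liu2021, Def. 4.11] `⊗'` survival machinery
`survival_atLine`) — so EVERY `ι_v(K_v)`-fixed class is `[Φ^{(v)} ⊗ 1_{𝒪_w}]` and `T(t₁)` acts on it by the scalar `ℓ(T 1_{𝒪_w})∕ℓ(1_{𝒪_w})`, `ℓ(Φ) = Φ(0)`.
DEGENERATE-CORNER PASS: `σ^K = 0` or `y = 0` — conclusion `0 = 0` ✓ harmless; `W = 0` ✓; `j` not injective EXCLUDED (else `σ` is unrelated to `ω⋆` and the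
eigenvalue is arbitrary) ✓; `S₀ := ` every place — EXCLUDED by `S₀.Finite` (infinitely many inert `v`, Chebotarev; the statement has content) ✓; a SPLIT `w`
EXCLUDED by `hw` (that case is ★ #30a) ✓; ramified ∕ dyadic ∕ bad-reduction `v` EXCLUDED twice (`hv h2 hdVw` AND the payer's `S₀`) — the explicit binders are
REDUNDANT given `∃ S₀` but kept token-identical with #28i's block so that #34 feeds one set of terms (typist note N2) ✓; `T ∉ GL₂(𝒪_w)` EXCLUDED by `hTi` ✓; no `t₁`
with `ht₁` unless `σ_w ϖ = ϖ` — `hϖσ` is a binder and ★ `exists_generator_inert` POPULATES `t₁` (no vacuity-by-falsity) ✓; `K` not hyperspecial at `v` EXCLUDED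
(else `heckeOperator σ K (ι_v t₁)` is not the local operator) ✓; ★ `heckeOperator`'s `finsum` has no junk: the `K`-orbit of `ι_v(t₁)K` in `U(V)(𝔸_f)∕K` is finite
(`K ⊇ ι_v(K_v)` open compact, `q² + q` points) ✓; `Z⁻¹` genuine (`Z ≠ 0`: `λ̃` is a character, ★ `valueAtUniformizer` of a unit idele) ✓; `q = residueCard v ≥ 2` ✓;
no measure, no integral, no `Classical.choice` datum in the statement ✓; `n'` free and `e₁` auxiliary exactly as in ★ #30a (general-`e₁` form, #30aT withdrawn) ✓.
Why it might fail: only by a CURRENCY slip between the three normalisations that meet here — (i) ★ `heckeOperator` = the algebraic sum over `K ι_v(t₁) K ∕ K`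
(`q² + q` terms), which ★ #30b matches with #28i's `ν(K_v) = 1` Bochner currency `∫_{K_v t₁ K_v} τ g u dν = a₁ • u` (= ★ `heckeOperator ρ K_v t₁ u` by ★
`heckeOperator_apply_eq_integral_holds`, `#(K_v t₁ K_v∕K_v) = q² + q` = ★ H3a `ncard_orbit_pow_inert` at `m = 1`; K2Liu-p01 (g4) note 04:16:38Z «keep (β) in that same
normalisation so #28i consumes it with no rescaling» — it is: `a₁(triv) = q² + q`, not `1` or `q + 1`); (ii) `Z` must be the UNITARY
`λ̃ = toHeckeCharacter L lam` at `ϖ_w` (★ #30a's `μ^{alg}` carries the extra `N(w)^{1∕2} = q` — reading `μ^{alg}` for `λ̃` would give `q²(Z+Z⁻¹)`-type nonsense);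
(iii) the torus orientation in (Ω4) (wrong ⇒ non-symmetric in `Z ↔ Z⁻¹`, self-detecting); or if at some inert good `v` the carrier's `ι_v(K_v)`-fixed classes were
NOT all of type `[Φ^{(v)} ⊗ 1_{𝒪_w}]` ((Ω5) above — then the `∀ y` form would need a `dim ≤ 1` guard `R`-edition; the elementary lattice argument says it does not).
[cite: Liu2021, Def. 4.11 (l. 2083–2097); App. D Lem. D.1 (l. 5226–5233)] [cite: GelbartRogawski1991, §3 pp. 455–459] [cite: Macdonald1971, Ch. V §3] [cite: Cartier1979, §IV]
[cite: Li1992, §3 Thm. 3.1] -/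
theorem sig_K2LiuThetaTypeSphericalEigenvalueInert :
    ∀ (L : Type) [Field L] [NumberField L] [IsCMField L]
      (dV : Fin 2 → L) (hdV : ∀ i, IsCMField.complexConj L (dV i) = dV i) (hdV0 : ∀ i, dV i ≠ 0)
      -- ★ #30a's θ-type block at `H := Matrix.diagonal dV` (no `finAdelicCongr`)
      {n' : ℕ} (e₁ : Fin 2 × Fin 1 ≃ Fin n')
      (lam : Literature.NumberTheory.Automorphic.IdeleClassGroup L →ₜ* Circle) (hlam : IsConjugateSymplectic L lam)
      (a : (↥(maximalRealSubfield L))ˣ) (χ : Chi (↥(maximalRealSubfield L)) L (IsCMField.complexConj L))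
      (W : Type) [AddCommGroup W] [Module ℂ W]
      (σ : Representation ℂ (finAdelic (↥(maximalRealSubfield L)) L (IsCMField.complexConj L) 2 (Matrix.diagonal dV)) W)
      (j : σ.IntertwiningMap
        (rhoVAtLine (↥(maximalRealSubfield L)) L (IsCMField.complexConj L) 2 e₁ (Matrix.diagonal dV)
            (complexConj_imagUnit L) (imagUnit_ne_zero L) (imagUnit_mul_self L) (realDiagonal_isSymm L dV hdV)
            (isUnit_det_realDiagonal L dV hdV hdV0) (realDiagonal_map L dV hdV).symm
            (fun a => isCompatible_chiSplittingLine L e₁ dV hdV hdV0 (toHeckeCharacter L lam)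
              (isUnitary_toHeckeCharacter L lam) ((isOscillatorChar_toHeckeCharacter_iff lam).mpr hlam)
              (TW (↥(maximalRealSubfield L)) a) (isSymm_TW (↥(maximalRealSubfield L)) a)
              (isUnit_det_TW (↥(maximalRealSubfield L)) a) (JW (↥(maximalRealSubfield L)) L a)
              (JW_eq (↥(maximalRealSubfield L)) L a)) a χ)),
      Function.Injective j →
      ∃ S₀ : Set (HeightOneSpectrum (𝓞 L)), S₀.Finite ∧
        ∀ (v : HeightOneSpectrum (𝓞 (Fp L))) (w : UnitaryGroup.PlacesOver L v), w.1 ∉ S₀ →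
          -- #28i's place block: INERT, UNRAMIFIED, non-dyadic, of good reduction for `V`
          ∀ (_hw : IsCMField.complexConj L • w.1 = w.1) (_hv : Algebra.IsUnramifiedIn (𝓞 L) v.asIdeal)
            (_h2 : ∀ w' : UnitaryGroup.PlacesOver L v, ValuativeRel.valuation (w'.1.adicCompletion L) (2 : w'.1.adicCompletion L) = 1)
            (_hdVw : ∀ (w' : UnitaryGroup.PlacesOver L v) (i : Fin 2),
              ValuativeRel.valuation (w'.1.adicCompletion L) (algebraMap L (w'.1.adicCompletion L) (dV i)) = 1)
            -- #28i's frame∕generator block: a `σ_w`-fixed uniformizer, an integral hyperbolic frame of the place form, the ONE Hecke generator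
            (ϖ : w.1.adicCompletion L) (_hϖ : Valued.v ϖ = WithZero.exp (-1 : ℤ))
            (_hϖσ : galAdicCompletionMap (L := L) (IsCMField.complexConj L) _hw ϖ = ϖ)
            (T : GL (Fin 2) (w.1.adicCompletion L)) (_hTi : T ∈ glInt 2 (w.1.adicCompletion L))
            (_hTJ : UnitaryGroup.placeForm (Matrix.diagonal dV) w.1 =
              formCongr (galAdicCompletionMap (L := L) (IsCMField.complexConj L) _hw) T ((StdForm.antidiagonal 2).over (w.1.adicCompletion L)))
            (t₁ : UnitaryGroup.localPi L (IsCMField.complexConj L) 2 (Matrix.diagonal dV) v)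
            (_ht₁ : (((t₁ : UnitaryGroup.LocalGLPi L 2 v) w : GL (Fin 2) (w.1.adicCompletion L)) : Matrix (Fin 2) (Fin 2) (w.1.adicCompletion L)) =
              ((T⁻¹ : GL (Fin 2) (w.1.adicCompletion L)) : Matrix (Fin 2) (Fin 2) (w.1.adicCompletion L)) *
                Matrix.diagonal ![ϖ, ϖ⁻¹] * (T : Matrix (Fin 2) (Fin 2) (w.1.adicCompletion L)))
            -- ★ #30a∕#30b's level∕vector block, generic Hecke operator (★ `heckeTAt` is split-only)
            (K : Subgroup ↥(finAdelic ↥(maximalRealSubfield L) L (IsCMField.complexConj L) 2 (Matrix.diagonal dV))),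
            UnitaryGroup.IsHyperspecialAt ↥(maximalRealSubfield L) L (IsCMField.complexConj L) 2 (Matrix.diagonal dV) K v →
            ∀ y ∈ σ.fixedPoints K,
              heckeOperator σ K
                  (UnitaryGroup.inclPlace ↥(maximalRealSubfield L) L (IsCMField.complexConj L) 2 (Matrix.diagonal dV) v t₁) y =
                ((v.residueCard : ℂ) *
                      ((toHeckeCharacter L lam).valueAtUniformizer w.1 + ((toHeckeCharacter L lam).valueAtUniformizer w.1)⁻¹) +
                    (v.residueCard : ℂ) - 1) • y :=
  K2LiuThetaTypeSphericalEigenvalueInert.thetaTypeSphericalEigenvalueInert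

end ThetaTypeInert

end Summit.HodgeConjecture.HodgeConjecture.Cruxes.HLiu418.K2LiuCurveThetaSigsU5eInertSeam
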